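import Summits.CriticalPhenomena.PercolationContinuityZ3.Theorems.Transplant.SkelSign1Params2
import HarnessLib

/-!
# D″ L7′ params, part 6: UNPACKING `signChoice₂` AT THE RUNNING DENSITY, I — under `hat : (Sgn₂.choiceAt κ Φ t p hC).AtQ O q`: the Step-I′ facts
# and the 8th fact by name, the zone scale, the UNITS (`n₀ ≤ e i`, `D.k ≤ e i`, the two room inequalities), the CELLS (`r i = A·e i`, `K`, `rmax`),
# the LISTS (merged range `Icc Smin Smax` in both; memberships = `hMz hℓK0 hℓK1 hS0 hS1` of `kitClause_stepI`, `hMℓ`), the STRIDES (`sS sL sC` vs `ℓ₀ ℓtop R′`: the `BandOK`/`LocOK`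
# arithmetic `hs hs2`, `2q + s₁ + R′ = L e`), the SPREADS (`MonoAbove` ⇒ `8·Gb ℓ ≤ r_y`, `8·Fb ℓ ≤ rₓ` for every certified extent) and the scale
# separation `3M + 3 ≤ R′`, `40·A·R′ ≤ e i` (twin of SkelConcParamsAtQ §AtQ, p238500; ledger SIGN-PARAMS.md §1K/1B/1L/§5)

builds on p205010 (kernel theorem, internal audit signed; external expert review pending) — nothing in this file uses p205010.
Status sentence (coordinator 2026-08-20T04:30Z): "θ(p_c) = 0 on ℤ^d, all d ≥ 2 — kernel-verified (Lean 4/Mathlib, standard axioms); internal adversarial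
audit SIGNED 2026-08-20 04:29Z; external expert review pending."
Lane `prim-bschramm-*`, seat `prim-bschramm-stmt` (gen 9); helper file (`--supports stmt-CriticalPhenomena-4575`).
Part II (`SkelSign1ParamsAtQ2`): counts at `q`, accuracies, inputs at coarser thresholds, the excess radius at `q`, the schedule by name.
[cite: KozmaNitzan2024, §4 Theorem 6 (pp. 25–31): the order of constants; Lemma 11 (pp. 22–23)]
-/

noncomputable section

open MeasureTheory
open scoped Classical

namespace Summit.CriticalPhenomena.PercolationContinuityZ3.Theorems.Transplant

namespace PlanarSkeletonSign

namespace Sgn₂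

open Literature.Probability.Percolation Literature.Probability.LatticeModels SimpleGraph
open SkelConc (Consts)
open Sgn (K a A L twenty_le_K one_le_a hundred_le_A K_le_A five_le_L sixteen_L_le_A δkit δI m₀ Mu ρz M T₀ Kd Rseed rs cU sB B kP NP Lcnt Rlev R' η reachK Sz L_hyps)
open BoxProdZ2 (Kof twenty_le_Kof le_Kof)
open SkelI (tanOff)
open Literature.Probability.Percolation.KozmaNitzan.Cells (oth)

section AtQ

variable {κ : Consts} {V : Type} [DecidableEq V] [Countable V] {G : SimpleGraph V} [G.LocallyFinite] {Φ : PlanarSkeletonSign G}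
  {t : V} {p : unitInterval} {hC : Φ.CylSubcritical p} {O : Skelφ.StepI.Out V} {q : unitInterval}
  (hat : (choiceAt κ Φ t p hC).AtQ O q)
include hat

/-! ## §1 The premises by name -/

/-- The seven Step-I′ facts. [folklore] -/
theorem facts_at : O.Facts Φ.frame hC (m₀ κ) := hat.1

/-- The 8th fact (a): the band widths are monotone above the seed scale. [folklore] -/
theorem mono_at : Skelφ.StepI.MonoAbove O.D := hat.2.1

/-- The 8th fact (b): the two-unit property with a stride factor. [folklore] -/
theorem two_at : Skelφ.StepI.TwoUnitL O.D := hat.2.2.1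

omit hat in
/-- `p/2 ≤ q` at the running density (the premise `(choiceAt κ Φ t p hC).AtQ O q` is an explicit binder here: the bare statement `(p : ℝ) / 2 ≤ q`
coincides textually with `BoxProdZ2.Conc.half_le_at`, which is about the box-product choices and not importable for these). [folklore] -/
theorem hq1_at (hAt : (choiceAt κ Φ t p hC).AtQ O q) : (p : ℝ) / 2 ≤ q := hAt.2.2.2.1

omit hat in
/-- `q ≤ p` at the running density (explicit premise, same reason as `hq1_at`; cf. `BoxProdZ2.Conc.le_at` for the box-product choices). [folklore] -/
theorem hq2_at (hAt : (choiceAt κ Φ t p hC).AtQ O q) : (q : ℝ) ≤ p := hAt.2.2.2.2.1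

/-- **The Step-I′ family over the chosen lists holds at `q` with accuracy `δI`.** [folklore] -/
theorem inputs_at : ∀ i ∈ Skelφ.StepI.index {t} (Sz O) (Sx κ Φ p O) (Sy κ Φ p O),
    1 - δI κ Φ < (bondPercolation G q).real (Skelφ.StepI.event G Φ.φ O.D i) := hat.2.2.2.2.2.1

/-- Φ2 at `q` (structure form). [folklore] -/
theorem cyl_at : Φ.CylSubcritical q := hat.2.2.2.2.2.2

/-- Φ2 at `q` (dictionary form). [folklore] -/
theorem cyl_at' : Skelφ.CylSubcritical G Φ.φ Φ.types q := hat.2.2.2.2.2.2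

/-- `m₀ ≤ D.k`, `1 ≤ D.k`, `2L + 1 ≤ D.k`, `7 ≤ D.k`. [folklore] -/
theorem k_facts : m₀ κ ≤ O.D.k ∧ 1 ≤ O.D.k ∧ 2 * L κ + 1 ≤ O.D.k ∧ 7 ≤ O.D.k := by
  have h := (facts_at hat).1
  have h7 : 7 ≤ m₀ κ := le_max_left _ _
  have hL : 2 * L κ + 1 ≤ m₀ κ := le_max_right _ _
  exact ⟨h, (facts_at hat).2.1, hL.trans h, h7.trans h⟩

/-- `D.R = fatRadius`, `D.Λ = fatSeqOff off`. [folklore] -/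
theorem R_Λ_eq : O.D.R = Skelφ.fatRadius Φ.frame hC ∧ O.D.Λ = Skelφ.fatSeqOff Φ.frame hC O.off :=
  ⟨(facts_at hat).2.2.1, (facts_at hat).2.2.2.1⟩

/-- `D.k < M₀`, `D.k < n₁`, `D.k ≤ Gb ℓ`, `D.k ≤ Fb ℓ`. [folklore] -/
theorem k_lt : O.D.k < O.M₀ ∧ O.D.k < O.n₁ ∧ ∀ ℓ, O.D.k ≤ O.D.Gb ℓ ∧ O.D.k ≤ O.D.Fb ℓ :=
  ⟨(facts_at hat).2.2.2.2.1, (facts_at hat).2.2.2.2.2.1, (facts_at hat).2.2.2.2.2.2⟩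

/-! ## §2 The zone scale -/

/-- `M₀ ≤ Mu`, `n₁ ≤ Mu`, `D.k < Mu` (so `hkz : D.k ≤ Mu`). [folklore] -/
theorem Mu_facts : O.M₀ ≤ Mu O ∧ O.n₁ ≤ Mu O ∧ O.D.k < Mu O ∧ O.D.k ≤ Mu O := by
  have h1 := Skelφ.Prm.M₀_le_Mu O.M₀ O.n₁
  have h2 := Skelφ.Prm.n₁_le_Mu O.M₀ O.n₁
  have h3 := (k_lt hat).1
  refine ⟨h1, h2, ?_, ?_⟩ <;> unfold Mu <;> omega

/-! ## §3 The units -/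

/-- The unit existential at `(8, A, L, n₀)`. [folklore] -/
theorem exists_unitSpec_at : ∃ ex ey, Skelφ.Prm.UnitSpec O.D 8 (A κ) (L κ) (n₀ κ Φ p O) ex ey :=
  exists_unitSpec κ Φ p (k_facts hat).1 (two_at hat)

/-- **`n₀ ≤ e i` and `D.k ≤ e i`.** [folklore] -/
theorem n₀_le_e_at (i : Fin 2) : n₀ κ Φ p O ≤ e κ Φ p O i ∧ O.D.k ≤ e κ Φ p O i := n₀_le_e κ Φ p (k_facts hat).1 (two_at hat) i

/-- **The two room inequalities of the units**: `8·Gb(L·e₀) ≤ A·e₁`, `8·Fb(L·e₁) ≤ A·e₀`. [folklore] -/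
theorem rooms_e_at : 8 * O.D.Gb (L κ * e κ Φ p O 0) ≤ A κ * e κ Φ p O 1 ∧ 8 * O.D.Fb (L κ * e κ Φ p O 1) ≤ A κ * e κ Φ p O 0 :=
  Skelφ.Prm.eOf_rooms (exists_unitSpec_at hat)

/-- `1 ≤ e i`. [folklore] -/
theorem one_le_e_at (i : Fin 2) : 1 ≤ e κ Φ p O i := (k_facts hat).2.1.trans (n₀_le_e_at hat i).2

/-- The floor unfolded: `Mu + R′ + 1 + 40·A·R′ ≤ e i`. [folklore] -/
theorem floor_le_e_at (i : Fin 2) : Mu O + R' κ Φ p O + 1 + 40 * A κ * R' κ Φ p O ≤ e κ Φ p O i := by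
  have h := (n₀_le_e_at hat i).1; unfold n₀ Sgn.n₀ at h; omega

/-- **`ρz ≤ e i`, hence `ψ(D.k) + off ≤ e i` and `D.k + off ≤ e i`** (the corrected floor: the wired seed's graph radius is below both planar
units — hp-8's (F) binder `hkR`). [folklore] -/
theorem ρz_le_e_at (i : Fin 2) : ρz O ≤ e κ Φ p O i ∧ O.D.R O.D.k + O.off ≤ e κ Φ p O i ∧ O.D.k + O.off ≤ e κ Φ p O i := by
  have h := (n₀_le_e_at hat i).1; unfold n₀ at h
  have hψ : O.D.R = Skelφ.fatRadius Φ.frame hC := (R_Λ_eq hat).1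
  have hmono : Monotone O.D.R := by rw [hψ]; exact Skelφ.fatRadius_mono Φ.frame hC
  have hk : O.D.R O.D.k ≤ O.D.R (Mu O) := hmono (Mu_facts hat).2.2.2
  have hid : O.D.k ≤ O.D.R O.D.k := by rw [hψ]; exact Skelφ.le_fatRadius Φ.frame hC _
  have hρ : ρz O = O.D.R (Mu O) + O.off := rfl
  omega

/-! ## §4 The cells -/

omit hat in
/-- `(cells).K = K = Kof K₀` and `K₀ ≤ K`, `20 ≤ K`. [folklore] -/
theorem cells_K_at : (cells κ Φ p O).K = K κ ∧ κ.K₀ ≤ (cells κ Φ p O).K ∧ 20 ≤ (cells κ Φ p O).K :=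
  ⟨rfl, le_Kof κ.K₀, twenty_le_Kof κ.K₀⟩

/-- **`r i = A·e i`.** [folklore] -/
theorem cells_r_at (i : Fin 2) : (cells κ Φ p O).r i = A κ * e κ Φ p O i := by
  show (Skelφ.Prm.cells (K κ) (a κ) (twenty_le_K κ) (e κ Φ p O)).r i = K κ * a κ * e κ Φ p O i
  exact Skelφ.Prm.cells_r (twenty_le_K κ) (one_le_a κ) (one_le_e_at hat i)

/-- `(cells).s i = a·e i`. [folklore] -/
theorem cells_s_at (i : Fin 2) : (cells κ Φ p O).s i = a κ * e κ Φ p O i := by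
  have h1 : 1 ≤ a κ * e κ Φ p O i := Nat.one_le_iff_ne_zero.2 (Nat.mul_ne_zero (by have := one_le_a κ; omega) (by have := one_le_e_at hat i; omega))
  show max 1 (a κ * e κ Φ p O i) = a κ * e κ Φ p O i
  exact max_eq_right h1

/-- `e i ≤ r i`, `A ≤ r i`, `100 ≤ r i`. [folklore] -/
theorem e_le_r_at (i : Fin 2) : e κ Φ p O i ≤ (cells κ Φ p O).r i ∧ A κ ≤ (cells κ Φ p O).r i ∧ 100 ≤ (cells κ Φ p O).r i := by
  rw [cells_r_at hat i]
  have hA := hundred_le_A κ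
  have he := one_le_e_at hat i
  refine ⟨Nat.le_mul_of_pos_left _ (by omega), Nat.le_mul_of_pos_right _ he, ?_⟩
  exact hA.trans (Nat.le_mul_of_pos_right _ he)

/-- `r i ≤ rmax` and `100 ≤ rmax` (so `4 ≤ rmax` for `fortyfour_le_E₀`). [folklore] -/
theorem r_le_rmax_at (i : Fin 2) : (cells κ Φ p O).r i ≤ (cells κ Φ p O).rmax ∧ 100 ≤ (cells κ Φ p O).rmax :=
  ⟨(cells κ Φ p O).r_le_rmax i, (e_le_r_at hat 0).2.2.trans ((cells κ Φ p O).r_le_rmax 0)⟩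

/-! ## §5 The lists -/

omit hat in
/-- **`hMz : Mu ∈ Sz`, `hℓK0 : Mu + 1 ∈ Sx`, `hℓK1 : Mu + 1 ∈ Sy`, `ℓ1ₓ ∈ Sx`, `ℓ1_y ∈ Sy`.** [folklore] -/
theorem mem_lists_at : Mu O ∈ Sz O ∧ Mu O + 1 ∈ Sx κ Φ p O ∧ Mu O + 1 ∈ Sy κ Φ p O ∧
    ℓ1 κ Φ p O 0 ∈ Sx κ Φ p O ∧ ℓ1 κ Φ p O 1 ∈ Sy κ Φ p O :=
  ⟨Skelφ.Prm.Mu_mem_SzOf _, Skelφ.Prm.succ_mem_SxOf _ _ _ _, Skelφ.Prm.succ_mem_SxOf _ _ _ _, Skelφ.Prm.ℓ1_mem_SxOf _ _ _ _,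
    Skelφ.Prm.ℓ1_mem_SxOf _ _ _ _⟩

omit hat in
/-- **`hS0`/`hS1` (merged form): the range `Icc Smin Smax` lies in BOTH lists** (pointwise). [folklore] -/
theorem mem_lists_of_Icc {ℓ : ℕ} (h₀ : Smin κ Φ p O ≤ ℓ) (h₁ : ℓ ≤ Smax κ Φ p O) : ℓ ∈ Sx κ Φ p O ∧ ℓ ∈ Sy κ Φ p O :=
  ⟨Skelφ.Prm.mem_SxOf_of_Icc _ _ h₀ h₁, Skelφ.Prm.mem_SxOf_of_Icc _ _ h₀ h₁⟩

/-- The merged range contains every per-axis range: `Smin ≤ ℓ₀ i` and `ℓtop i ≤ Smax`; and `Mu + 1 ≤ Smin`, `D.k ≤ Smin`. [folklore] -/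
theorem Smin_Smax_at (i : Fin 2) : Smin κ Φ p O ≤ ℓ₀ κ Φ p O i ∧ ℓtop κ Φ p O i ≤ Smax κ Φ p O ∧ Mu O + 1 ≤ Smin κ Φ p O ∧
    O.D.k ≤ Smin κ Φ p O := by
  have h0 := floor_le_e_at hat 0
  have h1 := floor_le_e_at hat 1
  have hk := (Mu_facts hat).2.2.2
  have hmin : ∀ j : Fin 2, emin κ Φ p O ≤ e κ Φ p O j := fun j => by
    fin_cases j
    · exact min_le_left _ _
    · exact min_le_right _ _
  have hmax : ∀ j : Fin 2, e κ Φ p O j ≤ emax κ Φ p O := fun j => by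
    fin_cases j
    · exact le_max_left _ _
    · exact le_max_right _ _
  have hfl : Mu O + R' κ Φ p O + 1 ≤ emin κ Φ p O := by
    unfold emin; rcases le_total (e κ Φ p O 0) (e κ Φ p O 1) with h | h
    · rw [min_eq_left h]; omega
    · rw [min_eq_right h]; omega
  have hi := hmin i
  refine ⟨?_, ?_, ?_, ?_⟩
  · unfold Smin ℓ₀; omega
  · unfold Smax ℓtop; exact Nat.mul_le_mul_left _ (hmax i)
  · unfold Smin; omega
  · unfold Smin; omega

/-- **`hS0`: the route range `Icc ℓ₀ₓ ℓtopₓ ⊆ Sx`** (pointwise; also `⊆ Sy`). [folklore] -/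
theorem mem_Sx_of_Icc {ℓ : ℕ} (h₀ : ℓ₀ κ Φ p O 0 ≤ ℓ) (h₁ : ℓ ≤ ℓtop κ Φ p O 0) : ℓ ∈ Sx κ Φ p O :=
  (mem_lists_of_Icc (κ := κ) ((Smin_Smax_at hat 0).1.trans h₀) (h₁.trans (Smin_Smax_at hat 0).2.1)).1

/-- **`hS1`: the route range `Icc ℓ₀_y ℓtop_y ⊆ Sy`** (pointwise; also `⊆ Sx`). [folklore] -/
theorem mem_Sy_of_Icc {ℓ : ℕ} (h₀ : ℓ₀ κ Φ p O 1 ≤ ℓ) (h₁ : ℓ ≤ ℓtop κ Φ p O 1) : ℓ ∈ Sy κ Φ p O :=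
  (mem_lists_of_Icc (κ := κ) ((Smin_Smax_at hat 1).1.trans h₀) (h₁.trans (Smin_Smax_at hat 1).2.1)).2

/-- The extents unfolded: `ℓ₀ i + R′ = e i`, `ℓ1 i = Mu + e i + 2R′ + 1`, `ℓtop i = L·e i`. [folklore] -/
theorem extents_eq_at (i : Fin 2) : ℓ₀ κ Φ p O i + R' κ Φ p O = e κ Φ p O i ∧ ℓ1 κ Φ p O i = Mu O + e κ Φ p O i + 2 * R' κ Φ p O + 1 ∧
    ℓtop κ Φ p O i = L κ * e κ Φ p O i := by
  have h := floor_le_e_at hat i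
  refine ⟨?_, rfl, rfl⟩
  unfold ℓ₀; omega

/-- **`hMℓ : Mu + 1 ≤ ℓ₀ i`** (route extents clear the kit zone box), and `D.k ≤ ℓ₀ i`. [folklore] -/
theorem Mu_succ_le_ℓ₀_at (i : Fin 2) : Mu O + 1 ≤ ℓ₀ κ Φ p O i ∧ O.D.k ≤ ℓ₀ κ Φ p O i := by
  have h := floor_le_e_at hat i
  have hk := (Mu_facts hat).2.2.2
  constructor <;> unfold ℓ₀ <;> omega

/-- `ℓ₀ i ≤ e i ≤ ℓ1 i ≤ ℓtop i` and `Mu + 1 ≤ ℓtop i` (every listed extent is `≤ L·e i` and `≥ D.k`). [folklore] -/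
theorem extents_le_at (i : Fin 2) : ℓ₀ κ Φ p O i ≤ e κ Φ p O i ∧ e κ Φ p O i ≤ ℓ1 κ Φ p O i ∧ ℓ1 κ Φ p O i ≤ ℓtop κ Φ p O i ∧
    Mu O + 1 ≤ ℓtop κ Φ p O i := by
  have h := floor_le_e_at hat i
  have hL := five_le_L κ
  have hA := hundred_le_A κ
  have h2 : 2 * e κ Φ p O i ≤ L κ * e κ Φ p O i := Nat.mul_le_mul_right _ (by omega)
  have hR2 : 2 * R' κ Φ p O ≤ 40 * A κ * R' κ Φ p O := by nlinarith
  have e1 : e κ Φ p O i ≤ ℓ1 κ Φ p O i := by unfold ℓ1; omega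
  have e2 : ℓ1 κ Φ p O i ≤ ℓtop κ Φ p O i := by unfold ℓ1 ℓtop; omega
  have e3 : Mu O + 1 ≤ ℓtop κ Φ p O i := by unfold ℓtop; omega
  exact ⟨Nat.sub_le _ _, e1, e2, e3⟩

/-- Every member of `Sx`/`Sy` lies in `[D.k, Smax]`. [folklore] -/
theorem mem_lists_bounds_at :
    (∀ ℓ ∈ Sx κ Φ p O, O.D.k ≤ ℓ ∧ ℓ ≤ Smax κ Φ p O) ∧ (∀ ℓ ∈ Sy κ Φ p O, O.D.k ≤ ℓ ∧ ℓ ≤ Smax κ Φ p O) := by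
  have hk := (Mu_facts hat).2.2.2
  have aux : ∀ i : Fin 2, ∀ ℓ ∈ Skelφ.Prm.SxOf (Mu O) (ℓ1 κ Φ p O i) (Smin κ Φ p O) (Smax κ Φ p O),
      O.D.k ≤ ℓ ∧ ℓ ≤ Smax κ Φ p O := by
    intro i ℓ hℓ
    have hb := extents_le_at hat i
    have hS := Smin_Smax_at hat i
    rcases Finset.mem_union.1 hℓ with h' | h'
    · rcases Finset.mem_insert.1 h' with rfl | h''
      · exact ⟨by omega, by omega⟩
      · rw [Finset.mem_singleton] at h''; subst h''; exact ⟨by have := Mu_succ_le_ℓ₀_at hat i; omega, hb.2.2.1.trans hS.2.1⟩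
    · have h3 := Finset.mem_Icc.1 h'; exact ⟨by omega, h3.2⟩
  exact ⟨aux 0, aux 1⟩

/-! ## §6 The strides (Band/Loc arithmetic) -/

/-- **Strides vs extents**: `sS i = e i`, `sL i + R′ = L·e i`, `2·ℓ₀ i + sC i + R′ = L·e i`, `R′ + ℓ₀ i ≤ sS i ≤ sL i`, `R′ + ℓ₀ i ≤ sC i`,
`2R′ ≤ sS i`, `sC i ≤ sL i + …` — the `hs`, `hs2`, `ℓ₁` facts of `BandOK`/`LocOK` for all three band kinds. [folklore] -/
theorem strides_at (i : Fin 2) :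
    sS κ Φ p O i = e κ Φ p O i ∧ sL κ Φ p O i + R' κ Φ p O = ℓtop κ Φ p O i ∧
    2 * ℓ₀ κ Φ p O i + sC κ Φ p O i + R' κ Φ p O = ℓtop κ Φ p O i ∧
    R' κ Φ p O + ℓ₀ κ Φ p O i ≤ sS κ Φ p O i ∧ R' κ Φ p O + ℓ₀ κ Φ p O i ≤ sL κ Φ p O i ∧ R' κ Φ p O + ℓ₀ κ Φ p O i ≤ sC κ Φ p O i ∧
    2 * R' κ Φ p O ≤ sS κ Φ p O i ∧ 2 * R' κ Φ p O ≤ sL κ Φ p O i ∧ 2 * R' κ Φ p O ≤ sC κ Φ p O i := by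
  have h := floor_le_e_at hat i
  have hL := five_le_L κ
  have hA := hundred_le_A κ
  set E := e κ Φ p O i with hE
  set R := R' κ Φ p O with hR
  have h3 : 3 * E ≤ (L κ - 2) * E := Nat.mul_le_mul_right _ (by omega)
  have h5 : 5 * E ≤ L κ * E := Nat.mul_le_mul_right _ hL
  have hsplit : L κ * E = (L κ - 2) * E + 2 * E := by
    rw [← Nat.add_mul]; congr 1; omega
  have hRE : 40 * A κ * R ≤ E := by omega
  have hRE' : 2 * R ≤ E := by nlinarith
  unfold sS sL sC ℓ₀ ℓtop
  rw [← hE, ← hR]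
  omega

/-! ## §7 The spreads (`MonoAbove` + the unit rooms) -/

/-- **Transverse spread of every certified `x`-extent**: `D.k ≤ ℓ ≤ L·eₓ ⇒ 8·Gb ℓ ≤ A·e_y = r_y`. [folklore] -/
theorem spread_x_at {ℓ : ℕ} (hk : O.D.k ≤ ℓ) (hℓ : ℓ ≤ ℓtop κ Φ p O 0) : 8 * O.D.Gb ℓ ≤ (cells κ Φ p O).r 1 := by
  rw [cells_r_at hat 1]
  have hm := ((mono_at hat) ℓ (L κ * e κ Φ p O 0) hk hℓ).1
  have hr := (rooms_e_at hat).1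
  omega

/-- **Transverse spread of every certified `y`-extent**: `D.k ≤ ℓ ≤ L·e_y ⇒ 8·Fb ℓ ≤ A·eₓ = rₓ`. [folklore] -/
theorem spread_y_at {ℓ : ℕ} (hk : O.D.k ≤ ℓ) (hℓ : ℓ ≤ ℓtop κ Φ p O 1) : 8 * O.D.Fb ℓ ≤ (cells κ Φ p O).r 0 := by
  rw [cells_r_at hat 0]
  have hm := ((mono_at hat) ℓ (L κ * e κ Φ p O 1) hk hℓ).2
  have hr := (rooms_e_at hat).2
  omega

/-- `Gb`/`Fb` are monotone on `[D.k, ∞)` (re-export of the 8th fact, pointwise). [folklore] -/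
theorem Gb_Fb_mono_at {ℓ ℓ' : ℕ} (hk : O.D.k ≤ ℓ) (h : ℓ ≤ ℓ') : O.D.Gb ℓ ≤ O.D.Gb ℓ' ∧ O.D.Fb ℓ ≤ O.D.Fb ℓ' := (mono_at hat) ℓ ℓ' hk h

/-- The width of axis `a` at extent `x`, transversally, is `Gb x` (`a = 0`) or `Fb x` (`a = 1`); it is monotone in `x ≥ D.k`. [folklore] -/
theorem widths_oth_mono (a : Fin 2) {x y : ℕ} (hk : O.D.k ≤ x) (h : x ≤ y) :
    Skelφ.StepI.widths O.D.Gb O.D.Fb a x (oth a) ≤ Skelφ.StepI.widths O.D.Gb O.D.Fb a y (oth a) := by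
  have hm := Gb_Fb_mono_at hat hk h
  fin_cases a
  · simpa [oth] using hm.1
  · simpa [oth] using hm.2


/-! ## §8 Scale separation: the kit/clamp scale against the band growth and the units -/

omit hat in
/-- `T₀ = 3M + 2`, `Rlev = T₀ + Lcnt`, `R′ = Rlev + 1` (so `3M + 3 ≤ R′`, `tanOff M M ≤ Rlev`, `Rlev + 1 ≤ R′`). [folklore] -/
theorem kit_scale_at : T₀ O = 3 * M O + 2 ∧ Rlev κ Φ p O = T₀ O + Lcnt κ Φ p O ∧ R' κ Φ p O = Rlev κ Φ p O + 1 ∧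
    3 * M O + 3 ≤ R' κ Φ p O ∧ tanOff (M O) (M O) ≤ Rlev κ Φ p O ∧ Mu O + 1 ≤ M O := by
  have hT : T₀ O = 3 * M O + 2 := by unfold T₀ tanOff; omega
  have hM : Mu O + 1 ≤ M O := Skelφ.Prm.Mu_succ_le_M O.D (Mu O)
  refine ⟨hT, rfl, rfl, ?_, ?_, hM⟩
  · unfold R' Rlev; omega
  · unfold Rlev; exact Nat.le_add_right _ _

/-- **The units dwarf every kit quantity**: `40·A·R′ ≤ e i`, `R′ ≤ e i`, `120·A·M ≤ e i`, `Mu < e i`. [folklore] -/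
theorem units_large_at (i : Fin 2) : 40 * A κ * R' κ Φ p O ≤ e κ Φ p O i ∧ R' κ Φ p O ≤ e κ Φ p O i ∧
    120 * A κ * M O ≤ e κ Φ p O i ∧ Mu O < e κ Φ p O i := by
  have h := floor_le_e_at hat i
  have hk := (kit_scale_at (κ := κ) (Φ := Φ) (p := p) (O := O)).2.2.2.1
  have hA := hundred_le_A κ
  refine ⟨by omega, by nlinarith, ?_, by omega⟩
  calc 120 * A κ * M O ≤ 40 * A κ * R' κ Φ p O := by nlinarith
    _ ≤ _ := by omega

end AtQ

end Sgn₂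

end PlanarSkeletonSign

end Summit.CriticalPhenomena.PercolationContinuityZ3.Theorems.Transplant

end
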